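import Summits.BirchSwinnertonDyer.Rank1Residual.Additive.X3BranchDegenerateEndState
import HarnessLib

/-!
# X3 certificate road: a LOWER BOUND on the residual count suffices — `…_of_lamGeW` and the
# DEGENERATE `p = 3` end states with `hn` weakened to `hnge : p^{n+Σδ+1} ≤ #H¹(ℚ_Σ/ℚ_∞, Φ₀)·#U`
# (cell `bsd-eis`, seat `bsd-eis-x3` gen 6; sequel of `X3BranchCertificateRoad[Gord].lean`,
# `X3BranchDegenerateEndState[OfFact].lean`; route K1 `AdditiveBranchIMC`, crux
# `GordTwoRankZeroOffCaseOne` — supports only)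

HONEST FRAMING (cell `bsd-eis`, `run/shared/lean/pub/bsd-eis/README.md` §4): the programme's target of
record is the full Birch–Swinnerton-Dyer formula for every `E/ℚ` of analytic rank `≤ 1`; this file
concerns the DEGENERATE X3♯(G-ord, `e = 2`) rows at `p = 3` (`W[3]^{ss} = {1, ω}`: the `−3`-twists of
ANOMALOUS good-ordinary curves with reducible `3`-torsion; 1 381 rank-`0` classes of referee A's
residue at state 16a6b5d318458b9f, each open exactly at `(3, X3)`). THEOREMS ONLY (no `def`, no named
fact, no `sorry`); nothing is booked; no label, tier or count of record moves.

## The observation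

In `X3Branch.charIdeal_eq_span_of_unitCoeffCert_of_lamEq` (`X3BranchCertificateRoad.lean` §1) the
algebraic input `λ(g) = n` is used ONLY through `λ(g·h) ≤ λ(g)`: Wuthrich's Thm. 16 gives
`g' = g·h ∈ char X = (g)` with `ι g' = u·ϖ·B`, the unit-coefficient certificate at index `n` gives
`μ(g') = 0`, `λ(g') ≤ n`, and the generator criterion `span_mul_eq_span_of_hasUnitContent_of_lam_le`
needs `λ(g·h) ≤ λ(g)`. Hence the algebraic half may be weakened to **`n ≤ λ(g)`** (§1), and the
degenerate rows' EVALUATION `hn : p^{n+Σδ+1} = #H¹(ℚ_Σ/ℚ_∞, Φ₀)·#U` to a LOWER BOUND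
`hnge : p^{n+Σδ+1} ≤ #H¹·#U` (sequel), which EXHIBITED classes supply; the exact evaluation
(class-field theory over `ℚ_∞`, x3-MEMO-2 D3, RULING L16 (b)) is not needed.

## Contents

* §1 `X3Branch.charIdeal_eq_span_of_unitCoeffCert_of_lamGe` (pointwise),
  `X3Branch.charIdeal_eq_span_of_unitCoeffCert_of_lamGeW` (`W`-level by eigen-descent),
  `X3Branch.lamGeW_of_countSucc_of_cardGe` (count `+1` + LOWER bound ⟹ `n ≤ λ(g)`).
* §2 the (G-ord, `e = 2`) rank-`0` wrappers with `hLamGeW`: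
  `X3Branch.chiBranchLowerDivisibilityAt_of_unitCoeffCert_of_lamGeW`,
  `ClassX3Gord.chiBranchLowerLeadingTerm[Odd]At_of_unitCoeffCert_of_lamGeW`,
  `ClassX3Gord.cycLowerLeadingTermAt_of_unitCoeffCert_of_lamGeW`,
  `ClassX3Gord.missingLowerBoundAt_rankZero_of_unitCoeffCert_of_lamGeW`,
  `ClassX3Gord.bsdp_three_rankZero_of_unitCoeffCert_of_lamGeW`.
* SEQUEL `X3BranchDegenerateEndStateCardGe.lean`: the DEGENERATE end states with `hnge`.
References: [Wuthrich2014] Thm. 16; [GreenbergVatsal2000] §2 pp. 26–30, p. 4; [Delbourgo1998] Prop. 4;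
[Pal2012] Thm. 3.2; [MazurTateTeitelbaum1986Invent] §I.13–I.14; [GreenbergLNM1716] §3, §5; [Washington1997]
§7.1; [Miller2011LMS] Def. 1.1; cell files `run/shared/lean/pub/bsd-eis/x3-MEMO-{2,3}.md`. -/

set_option autoImplicit false

noncomputable section
open scoped Classical MatrixGroups ModularForm AddSubgroup

namespace Summit.BirchSwinnertonDyer.Rank1Residual.Additive

open CongruenceSubgroup WeierstrassCurve NumberField IsDedekindDomain Field
  Literature.NumberTheory.EllipticCurves
  Literature.NumberTheory.EllipticCurves.ModularForms
  Literature.NumberTheory.EllipticCurves.GreenbergSelmer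
  Literature.NumberTheory.EllipticCurves.GreenbergVatsal2000
  Literature.NumberTheory.EllipticCurves.Rank1Residual
  Literature.NumberTheory.EllipticCurves.Rank1Residual.Typed
  Literature.NumberTheory.GaloisRepresentations
  Summit.BirchSwinnertonDyer.Rank1Residual.X1.MuLambda
  Summit.BirchSwinnertonDyer.Rank1Residual.AdditivePotMult
  Summit.BirchSwinnertonDyer.Rank1Residual.Additive.X3Branch

/-! ### §1 The certificate road with the algebraic half as an INEQUALITY `n ≤ λ(g)` -/

section Pointwise

variable {V : WeierstrassCurve ℚ} [V.IsElliptic] [V.IsGloballyMinimal] {p : ℕ} [hp : Fact p.Prime]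

/-- **CERTIFICATE ROAD, POINTWISE, with the algebraic half weakened to `n ≤ λ(g)`** (`hlam`):
Wuthrich gives `g' = g·h ∈ (g) = char D.X`, `ι g' = C(uϖ)B`; the certificate read on `Λ` gives
`μ(g') = 0`, `λ(g') ≤ n ≤ λ(g)`; the generator criterion gives `(gh) = (g)`.
[cite: Wuthrich2014, Thm. 16 (p. 397)] [cite: GreenbergVatsal2000, p. 4 (after Thm. (1.2))]
[cite: Washington1997, §7.1] -/
theorem X3Branch.charIdeal_eq_span_of_unitCoeffCert_of_lamGe
    (hW16 : Wuthrich2014.thm16_halfEigenCharIdeal_dvd_cyclotomicPrime) {n : ℕ}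
    (hcert : X3BranchUnitCoeffCertAt V p n)
    (K : Type) [Field K] [NumberField K] [(galRange (K := ℚ) K).Normal]
    (F : Type) [Field F] [NumberField F] [IsCyclotomicExtension {p} ℚ F]
    [(galRange (K := ℚ) F).Normal]
    {κ : ZpExtension ℚ p} {γ : Field.absoluteGaloisGroup ℚ} {N : ℕ} [NeZero N]
    {f : CuspForm (Gamma0 N) 2} {B : PowerSeries ℚ_[p]}
    (hp2 : p ≠ 2) (h2 : Module.finrank ℚ K = 2)
    (hθ : ∃ θ : K, θ ^ 2 = algebraMap ℚ K ((-1) ^ (p / 2) * p))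
    (hred : (IsOrdinaryAt V p ∧
        B = if Even (p / 2) then padicLFunctionBranch f ((unitRoot V p : ℤ_[p]) : ℚ_[p]) (p / 2)
          else padicLFunctionMinusBranch f ((unitRoot V p : ℤ_[p]) : ℚ_[p]) (p / 2)) ∨
      (V.HasSplitMultiplicativeReductionAtPrime p ∧
        B = if Even (p / 2) then padicLFunctionPlusBranchMult f (1 : ℚ_[p]) (p / 2)
          else padicLFunctionMinusBranchMult f (1 : ℚ_[p]) (p / 2)) ∨
      (V.HasMultiplicativeReductionAtPrime p ∧ ¬ V.HasSplitMultiplicativeReductionAtPrime p ∧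
        B = if Even (p / 2) then padicLFunctionPlusBranchMult f (-1 : ℚ_[p]) (p / 2)
          else padicLFunctionMinusBranchMult f (-1 : ℚ_[p]) (p / 2)))
    (hirr : ¬ V.HasIrreducibleModPGaloisRep p)
    (hκ : κ.IsCyclotomic) (hγ : κ.IsTopGenerator γ) (hcyc : IsCyclotomicVariable p γ)
    (hγK : γ ∈ galRange (K := ℚ) K) (hγF : γ ∈ galRange (K := ℚ) F) (hf : IsNewformOf V f)
    (D : V.EigenSelmerDualData p
        (κ.kerSubgroup ⊓ galRange (K := ℚ) K ⊓ galRange (K := ℚ) F) κ.kerSubgroup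
        (fun g ↦ if g ∈ galRange (K := ℚ) K then 1 else -1) γ)
    (ϖ : ℚ) (hϖ : if Even (p / 2) then (ϖ : ℝ) * V.realPeriodRat = plusPeriod f
        else (ϖ : ℝ) * V.imaginaryPeriodRat = minusPeriod f)
    (hlam : ∀ g : IwasawaAlgebra p, D.charIdeal = Ideal.span {g} → HasUnitContent g → n ≤ lam g) :
    Module.IsTorsion (IwasawaAlgebra p) D.X ∧
      ∃ g' : IwasawaAlgebra p, D.charIdeal = Ideal.span {g'} ∧ ∃ u : ℤ_[p]ˣ,
        iwasawaToPowerSeries p g' = PowerSeries.C (((u : ℤ_[p]) : ℚ_[p]) * (ϖ : ℚ_[p])) * B := by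
  obtain ⟨htors, g', hg'mem, u, hι⟩ :=
    hW16 p V K F B hp2 h2 hθ hred hirr hκ hγ hcyc hγK hγF hf D ϖ hϖ
  refine ⟨htors, ?_⟩
  obtain ⟨g, hg⟩ := (charIdeal_isPrincipal_holds p D.X).principal
  have hchar : D.charIdeal = Ideal.span {g} := hg
  obtain ⟨h, hfac⟩ : g ∣ g' := by
    rw [hchar] at hg'mem
    exact Ideal.mem_span_singleton.mp hg'mem
  subst hfac
  obtain ⟨hμ', hlam'⟩ :=
    hasUnitContent_and_lam_le_of_iota_eq_of_norm_coeff_eq_one hι (hcert f B ϖ hred hf hϖ)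
  have hμg : HasUnitContent g := X11a.hasUnitContent_left_of_mul hμ'
  have hlamg : n ≤ lam g := hlam g hchar hμg
  refine ⟨g * h, hchar.trans ?_, u, hι⟩
  exact (span_mul_eq_span_of_hasUnitContent_of_lam_le (X11a.ne_zero_of_hasUnitContent hμg) hμ'
    (hlam'.trans hlamg)).symm

end Pointwise

section WLevel

variable {V : WeierstrassCurve ℚ} [V.IsElliptic] [V.IsGloballyMinimal]
  {W : WeierstrassCurve ℚ} {p : ℕ} [hp : Fact p.Prime]

/-- **CERTIFICATE ROAD AT `W`-LEVEL with the algebraic half as an INEQUALITY** `hLamGeW` (for every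
cyclotomic `κ'`, generator `γ'`, TORSION dual datum `D'` of `Sel_{p^∞}(W/ℚ_∞)`, generator `g` of
`char D'.X` with `μ(g) = 0`: `n ≤ λ(g)`); eigen-descent as `…_of_lamEqW`, then §1 pointwise.
[cite: GreenbergLNM1716, §5 (PDF p. 143)] [cite: Wuthrich2014, Thm. 16 (p. 397)]
[cite: Delbourgo1998, Main Conjecture (p. 151)] [cite: GreenbergVatsal2000, p. 4 (after Thm. (1.2))] -/
theorem X3Branch.charIdeal_eq_span_of_unitCoeffCert_of_lamGeW
    (hW16 : Wuthrich2014.thm16_halfEigenCharIdeal_dvd_cyclotomicPrime)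
    (hp2 : p ≠ 2) (hirr : ¬ V.HasIrreducibleModPGaloisRep p) {C : VariableChange ℚ}
    (hC : C • V.quadraticTwist ((-1) ^ (p / 2) * p : ℚ) = W) {n : ℕ}
    (hcert : X3BranchUnitCoeffCertAt V p n)
    (hLamGeW : ∀ {κ : ZpExtension ℚ p} {γ : Field.absoluteGaloisGroup ℚ} (D : W.SelmerDualData κ γ)
      (g : IwasawaAlgebra p), κ.IsCyclotomic → κ.IsTopGenerator γ → D.IsTorsion →
      D.charIdeal = Ideal.span {g} → HasUnitContent g → n ≤ lam g)
    {κ : ZpExtension ℚ p} {γ : Field.absoluteGaloisGroup ℚ} {N : ℕ} [NeZero N]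
    {f : CuspForm (Gamma0 N) 2} {B : PowerSeries ℚ_[p]}
    (hκ : κ.IsCyclotomic) (hγ : κ.IsTopGenerator γ) (hcv : IsCyclotomicVariable p γ)
    (hf : IsNewformOf V f)
    (hred : (IsOrdinaryAt V p ∧
        B = if Even (p / 2) then padicLFunctionBranch f ((unitRoot V p : ℤ_[p]) : ℚ_[p]) (p / 2)
          else padicLFunctionMinusBranch f ((unitRoot V p : ℤ_[p]) : ℚ_[p]) (p / 2)) ∨
      (V.HasSplitMultiplicativeReductionAtPrime p ∧
        B = if Even (p / 2) then padicLFunctionPlusBranchMult f (1 : ℚ_[p]) (p / 2)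
          else padicLFunctionMinusBranchMult f (1 : ℚ_[p]) (p / 2)) ∨
      (V.HasMultiplicativeReductionAtPrime p ∧ ¬ V.HasSplitMultiplicativeReductionAtPrime p ∧
        B = if Even (p / 2) then padicLFunctionPlusBranchMult f (-1 : ℚ_[p]) (p / 2)
          else padicLFunctionMinusBranchMult f (-1 : ℚ_[p]) (p / 2)))
    (D : W.SelmerDualData κ γ) (ϖ : ℚ)
    (hϖ : if Even (p / 2) then (ϖ : ℝ) * V.realPeriodRat = plusPeriod f
        else (ϖ : ℝ) * V.imaginaryPeriodRat = minusPeriod f) :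
    D.IsTorsion ∧ ∃ g' : IwasawaAlgebra p, D.charIdeal = Ideal.span {g'} ∧ ∃ u : ℤ_[p]ˣ,
      iwasawaToPowerSeries p g' = PowerSeries.C (((u : ℤ_[p]) : ℚ_[p]) * (ϖ : ℚ_[p])) * B := by
  have hpS : ((-1 : ℚ) ^ (p / 2) * p) ≠ 0 := pStar_ne_zero p
  haveI hcycL : IsCyclotomicExtension {p} ℚ (CyclotomicField p ℚ) := by
    have h : (CyclotomicField.algebra p ℚ : Algebra ℚ (CyclotomicField p ℚ)) =
        DivisionRing.toRatAlgebra := Subsingleton.elim _ _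
    exact h ▸ CyclotomicField.isCyclotomicExtension p ℚ
  obtain ⟨K, θ, hK2, hθ, hθ2⟩ := exists_intermediateField_sq_eq_pStar p (CyclotomicField p ℚ) hp2
  haveI : NumberField K := NumberField.of_module_finite ℚ K
  haveI : IsGalois ℚ K := isGalois_of_finrank_eq_two K hK2
  haveI := normal_galRange K hK2 (sigmaQ_ne_one K hK2 hθ hθ2)
  haveI := normal_galRange_cyclotomic p (CyclotomicField p ℚ)
  haveI : (V.quadraticTwist ((-1 : ℚ) ^ (p / 2) * p)).IsElliptic := V.isElliptic_quadraticTwist hpS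
  obtain ⟨γ', hγ'KF, hκγ', ⟨g₀, hg₀, hγ'eq⟩, D', hchar, htor⟩ :=
    SelmerDualData.exists_chiEigenInCyclotomic p (CyclotomicField p ℚ) V K hK2 hθ hθ2 κ hC hp2 D
  have hγ' : κ.IsTopGenerator γ' := isTopGenerator_of_kappa_eq κ hκγ' hγ
  have hcv' : IsCyclotomicVariable p γ' := isCyclotomicVariable_of_eq_mul p κ hκ hg₀ hγ'eq hcv
  obtain ⟨htorsE, -⟩ := hW16 p V K (CyclotomicField p ℚ) _ hp2 hK2 ⟨θ, hθ2⟩ hred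
    hirr hκ hγ' hcv' (Subgroup.mem_inf.mp hγ'KF).1 (Subgroup.mem_inf.mp hγ'KF).2 hf
    (ChiEigenSelmerInDualData.toEigen V K κ (galRange (K := ℚ) (CyclotomicField p ℚ)) γ' D') ϖ hϖ
  have htorsD : D.IsTorsion := htor.mp htorsE
  have key := X3Branch.charIdeal_eq_span_of_unitCoeffCert_of_lamGe (V := V) hW16 hcert K
    (CyclotomicField p ℚ) (κ := κ) (γ := γ') (f := f) (B := B) hp2 hK2 ⟨θ, hθ2⟩ hred hirr hκ hγ'
    hcv' (Subgroup.mem_inf.mp hγ'KF).1 (Subgroup.mem_inf.mp hγ'KF).2 hf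
    (ChiEigenSelmerInDualData.toEigen V K κ (galRange (K := ℚ) (CyclotomicField p ℚ)) γ' D') ϖ hϖ
    (fun g hg hμ ↦ hLamGeW D g hκ hγ htorsD (hchar ▸ hg) hμ)
  obtain ⟨-, g', hchar', u, hι⟩ := key
  exact ⟨htorsD, g', hchar ▸ hchar', u, hι⟩

end WLevel

section Evaluation

variable {W : WeierstrassCurve ℚ} {p : ℕ} [hp : Fact p.Prime]

/-- **Count (`+1` form) + LOWER BOUND ⟹ `n ≤ λ(g)`**: from `p^{λ(g)+Σδ+1} = #H¹(ℚ_Σ/ℚ_∞, Φ₀)·#U`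
(`hcount`: `X3Branch.algebraicCountW[Mult]_degenerate_of_facts`) and `p^{n+Σδ+1} ≤ #H¹·#U` for every
cyclotomic `κ` (`hnge`, supplied by EXHIBITED classes). [cite: GreenbergVatsal2000, §2 Cor. (2.3), p. 30] -/
theorem X3Branch.lamGeW_of_countSucc_of_cardGe (S₀ : Finset (HeightOneSpectrum (𝓞 ℚ)))
    {Φ₀ : AddSubgroup (W.geomTorsion (p : ℤ))} (hΦ : IsRationalLine W p Φ₀) {n : ℕ}
    (hcount : ∀ {κ : ZpExtension ℚ p} {γ : Field.absoluteGaloisGroup ℚ} (D : W.SelmerDualData κ γ)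
      (g : IwasawaAlgebra p), κ.IsCyclotomic → κ.IsTopGenerator γ → D.IsTorsion →
      D.charIdeal = Ideal.span {g} → HasUnitContent g →
        p ^ (lam g + ∑ v ∈ S₀, delta W p v + 1) =
          Nat.card (residualLineH1 W p κ S₀ Φ₀ hΦ) * Nat.card (residualQuotSelmer W p κ S₀ Φ₀ hΦ))
    (hnge : ∀ (κ : ZpExtension ℚ p), κ.IsCyclotomic →
      p ^ (n + ∑ v ∈ S₀, delta W p v + 1) ≤
        Nat.card (residualLineH1 W p κ S₀ Φ₀ hΦ) * Nat.card (residualQuotSelmer W p κ S₀ Φ₀ hΦ))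
    {κ : ZpExtension ℚ p} {γ : Field.absoluteGaloisGroup ℚ} (D : W.SelmerDualData κ γ)
    (g : IwasawaAlgebra p) (hκ : κ.IsCyclotomic) (hγ : κ.IsTopGenerator γ) (hDt : D.IsTorsion)
    (hchar : D.charIdeal = Ideal.span {g}) (hμg : HasUnitContent g) : n ≤ lam g := by
  have hpow : p ^ (n + ∑ v ∈ S₀, delta W p v + 1) ≤ p ^ (lam g + ∑ v ∈ S₀, delta W p v + 1) :=
    (hnge κ hκ).trans_eq (hcount D g hκ hγ hDt hchar hμg).symm
  have := (Nat.pow_le_pow_iff_right hp.out.two_le).mp hpow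
  omega

end Evaluation

/-! ### §2 The (G-ord, `e = 2`) rank-`0` road with `hLamGeW` -/

section LowerInputs

variable {W : WeierstrassCurve ℚ} [W.IsElliptic] [W.IsGloballyMinimal] {p : ℕ} [hp : Fact p.Prime]

omit [W.IsGloballyMinimal] in
/-- **X3♯(G-ord, `e = 2`), `p ≡ 1 (mod 4)`: `ChiBranchLowerDivisibilityAt W p` from `hW16` + the
`W`-keyed certificate + `hLamGeW`.** As `X3Branch.chiBranchLowerDivisibilityAt_of_unitCoeffCert_of_lamEqW`.
[cite: SkinnerUrban2014, Thm. 3.6.4 (p. 43) (shape only)] [cite: Wuthrich2014, Thm. 16 (p. 397)] -/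
theorem X3Branch.chiBranchLowerDivisibilityAt_of_unitCoeffCert_of_lamGeW
    (hW16 : Wuthrich2014.thm16_halfEigenCharIdeal_dvd_cyclotomicPrime) (hred : Red W p) {n : ℕ}
    (hcert : ∀ (V : WeierstrassCurve ℚ) [V.IsElliptic] [V.IsGloballyMinimal] (C : VariableChange ℚ),
      C • V.quadraticTwist ((-1) ^ (p / 2) * p : ℚ) = W → X3BranchUnitCoeffCertAt V p n)
    (hLamGeW : ∀ {κ : ZpExtension ℚ p} {γ : Field.absoluteGaloisGroup ℚ} (D : W.SelmerDualData κ γ)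
      (g : IwasawaAlgebra p), κ.IsCyclotomic → κ.IsTopGenerator γ → D.IsTorsion →
      D.charIdeal = Ideal.span {g} → HasUnitContent g → n ≤ lam g) :
    ChiBranchLowerDivisibilityAt W p := by
  intro V _ _ κ γ N _ f hp1 hCW hgood hκ hγ hcv hf D ϖ hϖ g hg
  have hp2 : p ≠ 2 := by omega
  have heven' : Even (p / 2) := ⟨p / 4, by omega⟩
  have hpS : ((-1 : ℚ) ^ (p / 2) * p) ≠ 0 := pStar_ne_zero p
  obtain ⟨C, hC⟩ := hCW
  have hC' : C • V.quadraticTwist ((-1) ^ (p / 2) * p : ℚ) = W := by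
    rw [pStar_eq_self_of_mod_four_eq_one hp1]; exact hC
  have hirr : ¬ V.HasIrreducibleModPGaloisRep p := fun hV ↦
    hred ((irr_iff_of_model_twist (W := V) (p := p) hpS ⟨C, hC'⟩).mpr hV)
  have hord : IsOrdinaryAt V p := (isOrdinaryAt_iff V p).mpr ⟨hgood.1, hgood.2⟩
  obtain ⟨-, g', hchar, u, hι⟩ :=
    X3Branch.charIdeal_eq_span_of_unitCoeffCert_of_lamGeW hW16 hp2 hirr hC' (hcert V C hC') hLamGeW hκ
      hγ hcv hf (Or.inl ⟨hord, rfl⟩) D ϖ (by rw [if_pos heven']; exact hϖ)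
  rw [if_pos heven'] at hι
  have hg' : g ∈ Ideal.span ({g'} : Set (IwasawaAlgebra p)) := by rw [← hchar]; exact hg
  obtain ⟨a, rfl⟩ := Ideal.mem_span_singleton'.mp hg'
  refine ⟨PowerSeries.C (u : ℤ_[p]) * a, ?_⟩
  have hCu : PowerSeries.C ((((u : ℤ_[p]) : ℚ_[p])) * (ϖ : ℚ_[p])) =
      PowerSeries.C (((u : ℤ_[p]) : ℚ_[p])) * PowerSeries.C (ϖ : ℚ_[p]) := map_mul _ _ _
  rw [map_mul, hι, iwasawaToPowerSeries_C_mul', hCu]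
  ring

omit [W.IsGloballyMinimal] in
/-- **X3♯(G-ord), `p ≡ 1 (mod 4)`: `ChiBranchLowerLeadingTermAt W p` from `hW16` + the certificate +
`hLamGeW`.** [cite: MazurTateTeitelbaum1986Invent, §I.14] [cite: Wuthrich2014, Thm. 16 (p. 397)] -/
theorem ClassX3Gord.chiBranchLowerLeadingTermAt_of_unitCoeffCert_of_lamGeW
    (hW16 : Wuthrich2014.thm16_halfEigenCharIdeal_dvd_cyclotomicPrime) (hX : ClassX3Gord W p) {n : ℕ}
    (hcert : ∀ (V : WeierstrassCurve ℚ) [V.IsElliptic] [V.IsGloballyMinimal] (C : VariableChange ℚ),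
      C • V.quadraticTwist ((-1) ^ (p / 2) * p : ℚ) = W → X3BranchUnitCoeffCertAt V p n)
    (hLamGeW : ∀ {κ : ZpExtension ℚ p} {γ : Field.absoluteGaloisGroup ℚ} (D : W.SelmerDualData κ γ)
      (g : IwasawaAlgebra p), κ.IsCyclotomic → κ.IsTopGenerator γ → D.IsTorsion →
      D.charIdeal = Ideal.span {g} → HasUnitContent g → n ≤ lam g) :
    ChiBranchLowerLeadingTermAt W p :=
  chiBranchLowerLeadingTermAt_of_divisibility_of_padicValRat_j_nonneg p W
    (padicValRat_j_nonneg_of_typeGOrd W p hX.typeGOrd)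
    (X3Branch.chiBranchLowerDivisibilityAt_of_unitCoeffCert_of_lamGeW hW16 hX.classX3.1 hcert hLamGeW)

/-- **X3♯(G-ord, `e = 2`), `p ≡ 3 (mod 4)` (`p = 3` included): `ChiBranchLowerLeadingTermOddAt W p`
from `hW16` + the certificate + `hLamGeW`** (as
`ClassX3Gord.chiBranchLowerLeadingTermOddAt_of_unitCoeffCert_of_lamEqW`, MINUS branch).
[cite: MazurTateTeitelbaum1986Invent, §I.13–I.14] [cite: Wuthrich2014, Thm. 16 (p. 397)] -/
theorem ClassX3Gord.chiBranchLowerLeadingTermOddAt_of_unitCoeffCert_of_lamGeW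
    (hW16 : Wuthrich2014.thm16_halfEigenCharIdeal_dvd_cyclotomicPrime) (hX : ClassX3Gord W p)
    (he : semistabilityIndex W p = 2) {n : ℕ}
    (hcert : ∀ (V : WeierstrassCurve ℚ) [V.IsElliptic] [V.IsGloballyMinimal] (C : VariableChange ℚ),
      C • V.quadraticTwist ((-1) ^ (p / 2) * p : ℚ) = W → X3BranchUnitCoeffCertAt V p n)
    (hLamGeW : ∀ {κ : ZpExtension ℚ p} {γ : Field.absoluteGaloisGroup ℚ} (D : W.SelmerDualData κ γ)
      (g : IwasawaAlgebra p), κ.IsCyclotomic → κ.IsTopGenerator γ → D.IsTorsion →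
      D.charIdeal = Ideal.span {g} → HasUnitContent g → n ≤ lam g) :
    ChiBranchLowerLeadingTermOddAt W p := by
  intro V _ _ κ γ N _ f hp3 hCW _ hκ hγ hcv hf D ϖ hϖ g hg
  have hp2 : p ≠ 2 := by omega
  have hodd : ¬ Even (p / 2) := by rw [Nat.not_even_iff_odd]; exact ⟨p / 4, by omega⟩
  have hpS : ((-1 : ℚ) ^ (p / 2) * p) ≠ 0 := pStar_ne_zero p
  obtain ⟨C, hC⟩ := hCW
  have hC' : C • V.quadraticTwist ((-1) ^ (p / 2) * p : ℚ) = W := by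
    rw [pStar_eq_neg_of_mod_four_eq_three hp3]; exact hC
  have hgood : GoodOrd V p := TypeGOrd.goodOrd_of_pStar_twist_model hp2 hX.typeGOrd hX.addv he ⟨C, hC'⟩
  have hord : IsOrdinaryAt V p := (isOrdinaryAt_iff V p).mpr ⟨hgood.1, hgood.2⟩
  have hirr : ¬ V.HasIrreducibleModPGaloisRep p := fun hV ↦
    hX.classX3.1 ((irr_iff_of_model_twist (W := V) (p := p) hpS ⟨C, hC'⟩).mpr hV)
  obtain ⟨-, g', hchar, u, hι⟩ :=
    X3Branch.charIdeal_eq_span_of_unitCoeffCert_of_lamGeW hW16 hp2 hirr hC' (hcert V C hC') hLamGeW hκ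
      hγ hcv hf (Or.inl ⟨hord, rfl⟩) D ϖ (by rw [if_neg hodd]; exact hϖ)
  rw [if_neg hodd] at hι
  have hg' : g ∈ Ideal.span ({g'} : Set (IwasawaAlgebra p)) := by rw [← hchar]; exact hg
  obtain ⟨a, rfl⟩ := Ideal.mem_span_singleton'.mp hg'
  have hCu : PowerSeries.C ((((u : ℤ_[p]) : ℚ_[p])) * (ϖ : ℚ_[p])) =
      PowerSeries.C (((u : ℤ_[p]) : ℚ_[p])) * PowerSeries.C (ϖ : ℚ_[p]) := map_mul _ _ _
  have hιg : iwasawaToPowerSeries p (a * g') =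
      iwasawaToPowerSeries p (PowerSeries.C (u : ℤ_[p]) * a) *
        (PowerSeries.C ((ϖ : ℚ) : ℚ_[p]) *
          padicLFunctionMinusBranch f (unitRoot V p : ℚ_[p]) (p / 2)) := by
    rw [map_mul, hι, iwasawaToPowerSeries_C_mul', hCu]
    ring
  exact exists_padicInt_constantCoeff_eq_of_iwasawaToPowerSeries_eq_mul_minusBranch p hp2 V hord hf hιg

/-- **X3♯(G-ord) ∩ `I₀*` (`e = 2`), every odd `p`: `CycLowerLeadingTermAt W p` from `hW16` + the
certificate + `hLamGeW`** (Birch + Pal transport, both parities).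
[cite: Pal2012, Thm. 3.2] [cite: MazurTateTeitelbaum1986Invent, §I.13–I.14] [cite: Wuthrich2014, Thm. 16 (p. 397)] -/
theorem ClassX3Gord.cycLowerLeadingTermAt_of_unitCoeffCert_of_lamGeW
    (hW16 : Wuthrich2014.thm16_halfEigenCharIdeal_dvd_cyclotomicPrime)
    (hmod : hasEntireLFunction_rat) (hmodD : nonempty_modularParametrizationData)
    (hX : ClassX3Gord W p) (hp2 : p ≠ 2) (he : semistabilityIndex W p = 2) {n : ℕ}
    (hcert : ∀ (V : WeierstrassCurve ℚ) [V.IsElliptic] [V.IsGloballyMinimal] (C : VariableChange ℚ),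
      C • V.quadraticTwist ((-1) ^ (p / 2) * p : ℚ) = W → X3BranchUnitCoeffCertAt V p n)
    (hLamGeW : ∀ {κ : ZpExtension ℚ p} {γ : Field.absoluteGaloisGroup ℚ} (D : W.SelmerDualData κ γ)
      (g : IwasawaAlgebra p), κ.IsCyclotomic → κ.IsTopGenerator γ → D.IsTorsion →
      D.charIdeal = Ideal.span {g} → HasUnitContent g → n ≤ lam g) :
    CycLowerLeadingTermAt W p := by
  have hodd := hp.out.eq_two_or_odd'
  by_cases hp4 : p % 4 = 1
  · exact (cycLowerLeadingTermAt_iff_chiBranchLower_of_typeGOrd_of_semistabilityIndex_eq_two W p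
      pal2012_thm32_sqrt_mul_realPeriodRat_twist_eq_of_prime_one_mod_four_holds hmod hmodD hp4 hX.addv
      hX.typeGOrd he).mpr
      (ClassX3Gord.chiBranchLowerLeadingTermAt_of_unitCoeffCert_of_lamGeW hW16 hX hcert hLamGeW)
  · have hp4' : p % 4 = 3 := by
      rcases hodd with h | h
      · exact absurd h hp2
      · obtain ⟨k, hk⟩ := h; omega
    exact (cycLowerLeadingTermAt_iff_chiBranchLowerOdd_of_typeGOrd_of_semistabilityIndex_eq_two W p
      hmod hmodD hp4' hX.addv hX.typeGOrd he).mpr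
      (ClassX3Gord.chiBranchLowerLeadingTermOddAt_of_unitCoeffCert_of_lamGeW hW16 hX he hcert hLamGeW)

end LowerInputs

section EndStates

variable {W : WeierstrassCurve ℚ} [W.IsElliptic] [W.IsGloballyMinimal] {p : ℕ} [hp : Fact p.Prime]

/-- **X3♯(G-ord) ∩ `I₀*` (`e = 2`) ∧ `r_an = 0`, every odd `p`: `Typed.MissingLowerBoundAt W p` from
the PUBLISHED records + the certificate + `hLamGeW`** (as
`ClassX3Gord.missingLowerBoundAt_rankZero_of_unitCoeffCert_of_lamEqW`).
[cite: Delbourgo1998, Prop. 4 (p. 144)] [cite: GreenbergLNM1716, §3 Lemma 3.4 (p. 89)]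
[cite: Wuthrich2014, Thm. 16 (p. 397)] [cite: Pal2012, Thm. 3.2] [cite: Miller2011LMS, Def. 1.1] -/
theorem ClassX3Gord.missingLowerBoundAt_rankZero_of_unitCoeffCert_of_lamGeW
    (hDelG : Delbourgo1998.prop4_rankZero_constantCoeff_eq_unit_mul_of_potGoodOrd)
    (hGZK : rank_eq_analyticRank_of_analyticRank_le_one) (hmod : hasEntireLFunction_rat)
    (hmodD : nonempty_modularParametrizationData)
    (hW16 : Wuthrich2014.thm16_halfEigenCharIdeal_dvd_cyclotomicPrime)
    (hX : ClassX3Gord W p) (hp2 : p ≠ 2) (he : semistabilityIndex W p = 2) (hr : W.analyticRank = 0)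
    {n : ℕ}
    (hcert : ∀ (V : WeierstrassCurve ℚ) [V.IsElliptic] [V.IsGloballyMinimal] (C : VariableChange ℚ),
      C • V.quadraticTwist ((-1) ^ (p / 2) * p : ℚ) = W → X3BranchUnitCoeffCertAt V p n)
    (hLamGeW : ∀ {κ : ZpExtension ℚ p} {γ : Field.absoluteGaloisGroup ℚ} (D : W.SelmerDualData κ γ)
      (g : IwasawaAlgebra p), κ.IsCyclotomic → κ.IsTopGenerator γ → D.IsTorsion →
      D.charIdeal = Ideal.span {g} → HasUnitContent g → n ≤ lam g) :
    MissingLowerBoundAt W p :=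
  ClassX3Gord.missingLowerBoundAt_rankZero_of_cycLowerLeadingTerm_of_exact hGZK hmod hX hr
    (ClassX3Gord.cycLowerLeadingTermAt_of_unitCoeffCert_of_lamGeW hW16 hmod hmodD hX hp2 he hcert
      hLamGeW)
    (ClassX3Gord.exactLeadingTermAt_of_prop4Intrinsic hDelG hGZK hp2 hX hr)

/-- **X3♯(G-ord) ∩ `I₀*` at `p = 3`, `r_an = 0`: Miller's `BSD(E,3)` from the PUBLISHED records + the
certificate + `hLamGeW`** (as `ClassX3Gord.bsdp_three_rankZero_of_unitCoeffCert_of_lamEqW`: upper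
half = Wuthrich Thm. 16 on the minus eigenspace at `3` + De98 Prop. 4 weak form).
[cite: Delbourgo1998, Prop. 4 (p. 144)] [cite: Wuthrich2014, Thm. 16 (p. 397)]
[cite: Miller2011LMS, §1 and Def. 1.1] -/
theorem ClassX3Gord.bsdp_three_rankZero_of_unitCoeffCert_of_lamGeW [Fact (Nat.Prime 3)]
    {W : WeierstrassCurve ℚ} [W.IsElliptic] [W.IsGloballyMinimal]
    (hDelG : Delbourgo1998.prop4_rankZero_constantCoeff_eq_unit_mul_of_potGoodOrd)
    (hDel98 : Delbourgo1998.prop4_rankZero_pow_dvd_constantCoeff)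
    (hGZK : rank_eq_analyticRank_of_analyticRank_le_one) (hmod : hasEntireLFunction_rat)
    (hmodD : nonempty_modularParametrizationData)
    (hW16 : Wuthrich2014.thm16_halfEigenCharIdeal_dvd_cyclotomicPrime)
    (hX : ClassX3Gord W 3) (hr : W.analyticRank = 0) {n : ℕ}
    (hcert : ∀ (V : WeierstrassCurve ℚ) [V.IsElliptic] [V.IsGloballyMinimal] (C : VariableChange ℚ),
      C • V.quadraticTwist ((-1) ^ ((3 : ℕ) / 2) * (3 : ℕ) : ℚ) = W → X3BranchUnitCoeffCertAt V 3 n)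
    (hLamGeW : ∀ {κ : ZpExtension ℚ 3} {γ : Field.absoluteGaloisGroup ℚ} (D : W.SelmerDualData κ γ)
      (g : IwasawaAlgebra 3), κ.IsCyclotomic → κ.IsTopGenerator γ → D.IsTorsion →
      D.charIdeal = Ideal.span {g} → HasUnitContent g → n ≤ lam g) :
    BSDp W 3 :=
  have he : semistabilityIndex W 3 = 2 :=
    semistabilityIndex_eq_two_of_typeG_three W hX.typeGOrd.typeG hX.addv
  bsdp_of_missingPPartAt W 3 hGZK (by rw [hr]; exact zero_le_one)
    (missingPPartAt_of_lower_of_upper W 3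
      (ClassX3Gord.missingLowerBoundAt_rankZero_of_unitCoeffCert_of_lamGeW hDelG hGZK hmod hmodD hW16
        hX (by norm_num) he hr hcert hLamGeW)
      (AdditivePotMult.ClassX3Gord.missingUpperBoundAt_three_rankZero hDel98 hGZK hmod hmodD
        (thm16_minusEigenCharIdeal_dvd_cyclotomicThree_of_half hW16) hX he hr))

end EndStates

end Summit.BirchSwinnertonDyer.Rank1Residual.Additive
end
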